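import Literature.MathematicalPhysics.QuantumLattice.SectorPropagatorSupBound
import HarnessLib

/-!
# s-sectors and their nesting across scales (BGM 2006, (2.69); BGM 2003, §7.4)

Topic `Literature/MathematicalPhysics/QuantumLattice`. Benfatto–Giuliani–Mastropietro 2006, §2.7
(2.69): "We define, for any `h ≤ 0` and `ω ∈ O_h`, the s-sector
`S_{h,ω} = {k⃗ = ρ e⃗_r(θ) ∈ ℝ² : |ε_h(k⃗) - μ| ≤ γ^h e₀, ζ_{h,ω}(θ) ≠ 0}` and note that the definition
of s-sector has the property, to be used extensively in the following, that the s-sector `S_{h+1,ω}`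
of scale `h+1` contains the union of two s-sectors of scale `h`:
`S_{h+1,ω} ⊇ S_{h,2ω} ∪ S_{h,2ω+1}`, as follows from the definition of `ζ_{h,ω}`."
(Conventions: `γ = 4`, `h = -n`, `E_h ≡ ε`, angular functions `ζ̃_{n,ω} = sectorWeightCirc n ω` of
width `w_n = π2^{-n}`, `2^{n+1}` sectors.) PROVED here:

* `sectorWeight_pos_of_abs_lt` / `abs_lt_of_sectorWeight_ne_zero` — `ζ_{n,j}(θ) ≠ 0 ⟺ |θ - (j+½)w_n| < ¾w_n`
  (the bump profile is positive exactly on its open support);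
* `sectorWeightCirc_pos_of_abs_lt`, `exists_abs_lt_of_sectorWeightCirc_ne_zero` — the same on the circle;
* `sectorWeightCirc_ne_zero_of_child` — `ζ̃_{n+1,2ω}(θ) ≠ 0 ∨ ζ̃_{n+1,2ω+1}(θ) ≠ 0 ⟹ ζ̃_{n,ω}(θ) ≠ 0`;
* `sSector e₀ μ n ω` and **`sSector_child_subset`** — (2.69)+: `S_{n+1,2ω} ∪ S_{n+1,2ω+1} ⊆ S_{n,ω}`;
  **`sSector_subset_of_le`** — across several scales: `S_{n',ω'} ⊆ S_{n,ω'/2^{n'-n}}` for `n ≤ n'`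
  (BGM 2003 §7.4, condition (i) `S_{h',ω_i} ⊂ S_{h,ω̃_i}`).

Everything is PROVED; the only definition is `sSector`.

## Sources

* G. Benfatto, A. Giuliani, V. Mastropietro, Ann. Henri Poincaré 7 (2006) 809–898, §2.7 (2.69)
  (arXiv:cond-mat/0507686 p. 14). [BenfattoGiulianiMastropietro2006]
* G. Benfatto, A. Giuliani, V. Mastropietro, Ann. Henri Poincaré 4 (2003) 137–193, §7.4
  (arXiv:cond-mat/0207210 p. 28). [BenfattoGiulianiMastropietro2003]
-/

noncomputable section

open Real Set Metric

namespace Literature.MathematicalPhysics.QuantumLattice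

/-! ### Positivity of the angular functions on their open support -/

/-- The profile is positive on `|r| < ¾`. [folklore] -/
theorem sectorProfile_pos {r : ℝ} (hr : |r| < 3 / 4) : 0 < sectorProfile r :=
  sectorProfile_pos_of_abs_lt hr

/-- The unit weight is positive on `|r| < ¾`. [folklore] -/
theorem sectorUnitWeight_pos {r : ℝ} (hr : |r| < 3 / 4) : 0 < sectorUnitWeight r :=
  div_pos (sectorProfile_pos hr) (sectorProfileSum_pos r)

/-- **`|θ - (j+½)w_n| < ¾w_n ⟹ ζ_{n,j}(θ) > 0`.** [cite: BenfattoGiulianiMastropietro2006, §2.5 (2.45)] -/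
theorem sectorWeight_pos_of_abs_lt {n : ℕ} {j : ℤ} {θ : ℝ}
    (h : |θ - ((j : ℝ) + 1 / 2) * sectorWidth n| < 3 * sectorWidth n / 4) : 0 < sectorWeight n j θ := by
  have hw := sectorWidth_pos n
  apply sectorUnitWeight_pos
  rw [abs_div_sectorWidth_sub, div_lt_iff₀ hw]
  linarith

/-- **`ζ_{n,j}(θ) ≠ 0 ⟹ |θ - (j+½)w_n| < ¾w_n`.** [cite: BenfattoGiulianiMastropietro2006, §2.5 (2.45)] -/
theorem abs_lt_of_sectorWeight_ne_zero {n : ℕ} {j : ℤ} {θ : ℝ} (h : sectorWeight n j θ ≠ 0) :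
    |θ - ((j : ℝ) + 1 / 2) * sectorWidth n| < 3 * sectorWidth n / 4 := by
  by_contra hle
  exact h (sectorWeight_eq_zero (not_lt.1 hle))

/-- On the circle: a close translate makes `ζ̃_{n,ω}(θ) > 0`. [folklore] -/
theorem sectorWeightCirc_pos_of_abs_lt {n : ℕ} {ω : ℤ} {θ : ℝ} (k : ℤ)
    (h : |θ - ((ω : ℝ) + 1 / 2) * sectorWidth n - 2 * π * k| < 3 * sectorWidth n / 4) :
    0 < sectorWeightCirc n ω θ := by
  have hk : 0 < sectorWeight n (ω + k * sectorCount n) θ := by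
    apply sectorWeight_pos_of_abs_lt
    rw [sectorTranslate_center, ← sub_sub]
    exact h
  rw [sectorWeightCirc]
  exact lt_of_lt_of_le hk
    ((summable_sectorWeight_translate n ω θ).le_tsum k fun j _ => (sectorWeight_mem_Icc n _ θ).1)

/-- On the circle: `ζ̃_{n,ω}(θ) ≠ 0 ⟹` some translate is close. [folklore] -/
theorem exists_abs_lt_of_sectorWeightCirc_ne_zero {n : ℕ} {ω : ℤ} {θ : ℝ} (h : sectorWeightCirc n ω θ ≠ 0) :
    ∃ k : ℤ, |θ - ((ω : ℝ) + 1 / 2) * sectorWidth n - 2 * π * k| < 3 * sectorWidth n / 4 := by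
  by_contra hne
  push Not at hne
  exact h (sectorWeightCirc_eq_zero hne)

/-- The width halves: `w_{n+1} = w_n/2`. [folklore] -/
theorem sectorWidth_succ (n : ℕ) : sectorWidth (n + 1) = sectorWidth n / 2 := by
  rw [sectorWidth, sectorWidth, pow_succ]; ring

/-- **The children light up the parent**: `ζ̃_{n+1,2ω}(θ) ≠ 0 ∨ ζ̃_{n+1,2ω+1}(θ) ≠ 0 ⟹ ζ̃_{n,ω}(θ) > 0`
(the children's supports `(ω+¼ ± ⅜)w_n`, `(ω+¾ ± ⅜)w_n` lie inside `(ω+½ ± ¾)w_n`). [cite: BenfattoGiulianiMastropietro2006, §2.7 (2.69)] -/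
theorem sectorWeightCirc_pos_of_child {n : ℕ} {ω : ℤ} {θ : ℝ}
    (h : sectorWeightCirc (n + 1) (2 * ω) θ ≠ 0 ∨ sectorWeightCirc (n + 1) (2 * ω + 1) θ ≠ 0) :
    0 < sectorWeightCirc n ω θ := by
  have hw := sectorWidth_pos n
  have hws := sectorWidth_succ n
  rcases h with h | h
  · obtain ⟨k, hk⟩ := exists_abs_lt_of_sectorWeightCirc_ne_zero h
    refine sectorWeightCirc_pos_of_abs_lt k ?_
    rw [hws] at hk
    push_cast at hk
    rw [abs_lt] at hk ⊢
    constructor <;> nlinarith [hk.1, hk.2]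
  · obtain ⟨k, hk⟩ := exists_abs_lt_of_sectorWeightCirc_ne_zero h
    refine sectorWeightCirc_pos_of_abs_lt k ?_
    rw [hws] at hk
    push_cast at hk
    rw [abs_lt] at hk ⊢
    constructor <;> nlinarith [hk.1, hk.2]

/-- Hence `ζ̃_{n,ω}(θ) ≠ 0`. [cite: BenfattoGiulianiMastropietro2006, §2.7 (2.69)] -/
theorem sectorWeightCirc_ne_zero_of_child {n : ℕ} {ω : ℤ} {θ : ℝ}
    (h : sectorWeightCirc (n + 1) (2 * ω) θ ≠ 0 ∨ sectorWeightCirc (n + 1) (2 * ω + 1) θ ≠ 0) :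
    sectorWeightCirc n ω θ ≠ 0 :=
  (sectorWeightCirc_pos_of_child h).ne'

/-! ### s-sectors -/

/-- **The s-sector** `S_{h,ω} = {k⃗ : |ε(k⃗) - μ| ≤ γ^h e₀, ζ̃_{h,ω}(θ(k⃗)) ≠ 0}` (`γ^h = 4^{-n}`). [cite: BenfattoGiulianiMastropietro2006, §2.7 (2.69)] -/
def sSector (e₀ μ : ℝ) (n : ℕ) (ω : ℤ) : Set (Fin 2 → ℝ) :=
  {k | |sqDispersion k - μ| ≤ e₀ * (4 : ℝ) ^ (-(n : ℤ)) ∧ sectorWeightCirc n ω (polarAngle k) ≠ 0}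

/-- **Nesting (2.69)+: `S_{n+1,2ω} ∪ S_{n+1,2ω+1} ⊆ S_{n,ω}`** (in BGM's scales: `S_{h+1,ω} ⊇ S_{h,2ω} ∪ S_{h,2ω+1}`). [cite: BenfattoGiulianiMastropietro2006, §2.7 (2.69)] -/
theorem sSector_child_subset {e₀ : ℝ} (he : 0 ≤ e₀) (μ : ℝ) (n : ℕ) (ω : ℤ) :
    sSector e₀ μ (n + 1) (2 * ω) ∪ sSector e₀ μ (n + 1) (2 * ω + 1) ⊆ sSector e₀ μ n ω := by
  have h4 : (4 : ℝ) ^ (-((n + 1 : ℕ) : ℤ)) ≤ (4 : ℝ) ^ (-(n : ℤ)) :=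
    zpow_le_zpow_right₀ (by norm_num) (by push_cast; linarith)
  rintro k (⟨hk1, hk2⟩ | ⟨hk1, hk2⟩)
  · exact ⟨hk1.trans (mul_le_mul_of_nonneg_left h4 he), sectorWeightCirc_ne_zero_of_child (Or.inl hk2)⟩
  · exact ⟨hk1.trans (mul_le_mul_of_nonneg_left h4 he), sectorWeightCirc_ne_zero_of_child (Or.inr hk2)⟩

/-- One step with natural indices: `S_{n+1,ω'} ⊆ S_{n,ω'/2}`. [cite: BenfattoGiulianiMastropietro2006, §2.7 (2.69)] -/
theorem sSector_succ_subset {e₀ : ℝ} (he : 0 ≤ e₀) (μ : ℝ) (n : ℕ) (ω' : ℕ) :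
    sSector e₀ μ (n + 1) (ω' : ℤ) ⊆ sSector e₀ μ n ((ω' / 2 : ℕ) : ℤ) := by
  have h := sSector_child_subset he μ n ((ω' / 2 : ℕ) : ℤ)
  rcases Nat.even_or_odd ω' with ⟨m, hm⟩ | ⟨m, hm⟩
  · have h1 : ((ω' : ℕ) : ℤ) = 2 * (((ω' / 2 : ℕ)) : ℤ) := by omega
    rw [h1]
    exact (subset_union_left).trans h
  · have h1 : ((ω' : ℕ) : ℤ) = 2 * (((ω' / 2 : ℕ)) : ℤ) + 1 := by omega
    rw [h1]
    exact (subset_union_right).trans h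

/-- **Nesting across scales**: for `n ≤ n'`, `S_{n',ω'} ⊆ S_{n,ω'/2^{n'-n}}` — every fine s-sector lies in
the coarse s-sector it refines (BGM 2003 §7.4 (i)). [cite: BenfattoGiulianiMastropietro2003, §7.4] -/
theorem sSector_subset_of_le {e₀ : ℝ} (he : 0 ≤ e₀) (μ : ℝ) {n n' : ℕ} (hn : n ≤ n') (ω' : ℕ) :
    sSector e₀ μ n' (ω' : ℤ) ⊆ sSector e₀ μ n ((ω' / 2 ^ (n' - n) : ℕ) : ℤ) := by
  obtain ⟨d, rfl⟩ := Nat.exists_eq_add_of_le hn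
  rw [Nat.add_sub_cancel_left]
  clear hn
  induction d generalizing ω' with
  | zero => simp
  | succ d ih =>
    have h1 := sSector_succ_subset he μ (n + d) ω'
    rw [show n + (d + 1) = n + d + 1 by ring]
    refine h1.trans ?_
    have h2 := ih (ω' / 2)
    rwa [Nat.div_div_eq_div_mul, ← pow_succ'] at h2

end Literature.MathematicalPhysics.QuantumLattice

end
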